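import Summits.AtomisticToContinuum.Crystallization.Theses.PRVarianceCertificate
import Summits.AtomisticToContinuum.Crystallization.Theorems.PRVarianceCertificateCoerciveVarianceCertificateMatching
import HarnessLib

/-!
# Line `birth` for piece `PricingLarge` of crux `CoerciveVarianceCertificate` (route `PRVarianceCertificate`) — birth skeleton (BC3)

Piece (verbatim the registered stub `stub_pricingLarge` of `Cruxes/CoerciveVarianceCertificate/Lines/birth.lean`;
route item `PRVarianceCertificate.PricingLarge` once the split `CoerciveVarianceCertificate ⇐ PricingLarge ∧ CoarseToFine`
is filed): COARSE PRICING BY DEFICIT, template and constant pinned — for every optimal hcp pair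
`(a, h)`, with `C := -24 · e_LJ(hcp_{a,h})` (`= Φ(hcp) ≈ 17.2222`), some `c₀ > 0` gives, for every
Lennard-Jones ground state `x` of `N ≥ 19` particles,
`c₀ · #{i : the 2a-window at x_i is not (a/100)-congruent (linear isometry, two-way) to a window of hcp_{a,h}}
 ≤ D(x) := C · Σ_j t_j − Σ_j s_j²`  (`s_j = Σ_{k ≠ j} r_jk⁻⁶`, `t_j = Σ_{k ≠ j} r_jk⁻¹²`).

## The line: CREDIT LEDGER — over-collateralised debts × a creditor next to every defect × Markov

Write the deficit as a sum of LOCAL DEFICITS `d_j := C t_j − s_j² = t_j (C − n_j)`, `n_j := s_j²/t_j` the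
effective coordination (`= C` exactly at bulk hcp sites; `< C` = CREDIT at surfaces, vacancies,
crowded/polytetrahedral shells, c-stacked sites, sheared sites; `> C` = DEBT at sites whose first
shell is locally dilated against its far field, Frank–Kasper centres, halo'd sites).  `D = Σ_j d_j⁺ − Σ_j d_j⁻`.

* `stub_collateral` (size XL; the certificate half; hardest) — DEBTS ARE UNIFORMLY OVER-COLLATERALISED:
  some `ε > 0` makes `ε · Σ_j d_j⁺ ≤ D` on every LJ ground state with `N ≥ 19`, i.e.
  `Σ_j d_j⁻ ≤ (1 − ε) Σ_j d_j⁺`.  At `ε = 0` this is crux 11859 `GroundStateVarianceCertificate` pinned at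
  hcp (`D ≥ 0`); the stub is its coercive CREDIT form (gross credit, not defect count, is the currency).
  Why plausible: every known debtor sits next to larger credit (Bergman/FK centre debt ≈ 6 vs shell
  credit ≈ 96; a first shell dilated by `η` owes `≈ 400 η` while the missing/stretched bonds that cause
  it credit `≈ 10` each; small clusters have `D ≈ Σt (C − Ψ)`, `Ψ ≤ 13.6` for `N ≤ 309`).  Why it might
  fail = why 11859 might: a ground-state family whose site-variance beats its participation deficit.
* `stub_localCredit` (size L/XL; regularity in COUNTING form, no certificate content) — A CREDITOR NEXT
  TO EVERY DEFECT: there are `N₀, ρ, c₁ > 0` such that in every LJ ground state with `N ≥ N₀` every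
  coarse-bad particle has a particle within `ρ` carrying credit `d_j ≥ c₁`.  Coordination defects,
  surfaces, stacking faults (`d = (Φ_hcp − Φ_fcc) t ≈ 0.022` at a c-site), grain boundaries and SHEARED
  elastic fields (`d ≈ K' η² t`, `n` is maximal at relaxed hcp to second order in traceless strain) carry
  their own credit; the one credit-free way to be coarse-bad is (nearly) PURE DILATION (`n` is
  dilation-invariant), which in equilibrium is sourced only by surface stress — uniform `∼ N^{-1/3}` in
  mid-size clusters (hence `N₀`) and `∼ (f/K)/d` at depth `d` below edges of large ones (hence `ρ`,
  existential and large: every site within `ρ` of the surface sees a surface creditor, `d ≈ 40`).  Why it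
  might fail: a dilation-dominated, shear-poor strain pocket deeper than `ρ` in a large ground state.
* `stub_exposedCredit` (size M; geometry + minimal distance) — EVERY CLUSTER HAS A CREDITOR: some
  `c₃ > 0` such that every LJ ground state (`N ≥ 19`) has a site with `d_j ≥ c₃` (an extreme point of
  the configuration has all neighbours in a half-space: `n_j ≲ 9–13 < 17.2` under the uniform minimal
  distance `0.68` of LJ ground states).  Pays for mid-size clusters (`N < N₀`, where `#bad ≤ N₀`).
* `PricingLarge_of_stubs` — the kernel-checked composition (no `sorry` outside `stub_*`): `δ` from
  `LennardJonesMinimalDistance_holds`, `K := (2ρ/δ + 1)³` (`card_le_of_separated_of_dist_le`),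
  `c₀ := min (ε c₃/(N₀+1)) (ε c₁/K)`.  For `N ≤ N₀`: `c₀ · #bad ≤ ε c₃ · N/(N₀+1) ≤ ε c₃ ≤ ε d_{j₀}⁺ ≤
  ε Σ d⁺ ≤ D`.  For `N > N₀`: `#bad ≤ K · #{j : d_j ≥ c₁}` (a creditor within `ρ` of each defect, at most
  `K` particles within `ρ` of a creditor) and Markov `c₁ · #{j : d_j ≥ c₁} ≤ Σ_j d_j⁺ ≤ D/ε`.

No stub is the piece re-packaged: collateral counts no defects (credit-valued), local credit and
exposed credit assert no sign for `D`.  The certificate kernel (11859 at hcp, `N ≥ 19`) sits inside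
`stub_collateral` and nowhere else — unavoidable, since the piece contains it
(`pricingLarge-contains-11859.lean`, lead c2) — but in a form with a lever of its own (credit ratio).
Disproof.lean: none for the parent crux (2026-08-17).  Negatives (22; this sub: 3506, 4146, 15929,
17253): 17253 `OneMultiplierPricing` (pricing LINEAR in a mismatch, killed by dilated ground states) —
here credit is the certificate's own local deficit at ONE tolerance with existential constants, and
dilates of ground states are not ground states; 3506 pile-up — ground states are injective and
`δ`-separated; 4146/15929 shell censuses — none asserted.
-/

noncomputable section

namespace Summit.AtomisticToContinuum.Crystallization.Cruxes.PricingLarge.Birth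

open scoped BigOperators

/-! ## Registered stubs (sorries live ONLY here; signatures fully inlined, one line each) -/

/-- **STUB T — debts are uniformly over-collateralised** (size XL; the certificate half; hardest).
For the optimal hcp pair `(a, h)`, `C := -24 · e_LJ(hcp_{a,h})`, some `ε > 0` gives on every
Lennard-Jones ground state `x` with `N ≥ 19`: `ε · Σ_j max(0, C t_j − s_j²) ≤ C Σ_j t_j − Σ_j s_j²`
(equivalently `Σ_j d_j⁻ ≤ (1 − ε) Σ_j d_j⁺`).  Contains crux 11859 pinned at hcp (`ε → 0`). -/
theorem stub_collateral : ∀ (a h : ℝ) (ha : 0 < a) (hh : 0 < h), (∀ (a' h' : ℝ) (ha' : a' ≠ 0) (hh' : h' ≠ 0), (Literature.MathematicalPhysics.StatisticalMechanics.hcpPeriodicConfiguration ha.ne' hh.ne').energyPerParticle Literature.MathematicalPhysics.StatisticalMechanics.lennardJones ≤ (Literature.MathematicalPhysics.StatisticalMechanics.hcpPeriodicConfiguration ha' hh').energyPerParticle Literature.MathematicalPhysics.StatisticalMechanics.lennardJones) → ∃ ε : ℝ, 0 < ε ∧ ∀ (N : ℕ) (x : Fin N → EuclideanSpace ℝ (Fin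 3)), Literature.MathematicalPhysics.StatisticalMechanics.IsGroundState Literature.MathematicalPhysics.StatisticalMechanics.lennardJones x → 19 ≤ N → ε * ∑ j, max 0 ((-(24 : ℝ) * (Literature.MathematicalPhysics.StatisticalMechanics.hcpPeriodicConfiguration ha.ne' hh.ne').energyPerParticle Literature.MathematicalPhysics.StatisticalMechanics.lennardJones) * Literature.MathematicalPhysics.StatisticalMechanics.siteEnergy (fun r => (r⁻¹) ^ 12) x j - (Literature.MathematicalPhysics.StatisticalMechanics.siteEnergy (fun r => (r⁻¹) ^ 6) x j) ^ 2) ≤ (-(24 : ℝ) * (Literature.MathematicalPhysics.StatisticalMechanics.hcpPeriodicConfiguration ha.ne' hh.ne').energyPerParticle Literature.MathematicalPhysics.StatisticalMechanics.lennardJones) * ∑ i, Literature.MathematicalPhysics.StatisticalMechanics.siteEnergy (fun r => (r⁻¹) ^ 12) x i - ∑ i, (Literature.MathematicalPhysics.StatisticalMechanics.siteEnergy (fun r => (r⁻¹) ^ 6) x i) ^ 2 := by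
  sorry

/-- **STUB L — a creditor next to every coarse defect, for large clusters** (size L/XL; interior
regularity of LJ ground states in counting form; no certificate content).  For the optimal `(a, h)`
there are `N₀`, `ρ > 0`, `c₁ > 0` such that in every Lennard-Jones ground state with `N ≥ N₀` every
particle whose `2a`-window is NOT `(a/100)`-congruent to a window of `hcp_{a,h}` has a particle within
`ρ` with local deficit `C t_j − s_j² ≥ c₁`. -/
theorem stub_localCredit : ∀ (a h : ℝ) (ha : 0 < a) (hh : 0 < h), (∀ (a' h' : ℝ) (ha' : a' ≠ 0) (hh' : h' ≠ 0), (Literature.MathematicalPhysics.StatisticalMechanics.hcpPeriodicConfiguration ha.ne' hh.ne').energyPerParticle Literature.MathematicalPhysics.StatisticalMechanics.lennardJones ≤ (Literature.MathematicalPhysics.StatisticalMechanics.hcpPeriodicConfiguration ha' hh').energyPerParticle Literature.MathematicalPhysics.StatisticalMechanics.lennardJones) → ∃ N₀ : ℕ, ∃ ρ c₁ : ℝ, 0 < ρ ∧ 0 < c₁ ∧ ∀ (N : ℕ) (x : Fin N → EuclideanSpace ℝ (Fin 3)), Literature.MathematicalPhysics.StatisticalMechanics.IsGroundState Literature.MathematicalPhysics.StatisticalMechanics.lennardJones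 x → N₀ ≤ N → ∀ i : Fin N, ¬ (∃ A : EuclideanSpace ℝ (Fin 3) →ₗᵢ[ℝ] EuclideanSpace ℝ (Fin 3), (∀ p ∈ (Literature.MathematicalPhysics.StatisticalMechanics.hcpPeriodicConfiguration ha.ne' hh.ne').points, ‖p‖ ≤ 2 * a → ∃ k : Fin N, dist (x k) (x i + A p) ≤ a / 100) ∧ (∀ k : Fin N, dist (x k) (x i) ≤ 2 * a → ∃ p ∈ (Literature.MathematicalPhysics.StatisticalMechanics.hcpPeriodicConfiguration ha.ne' hh.ne').points, dist (x k) (x i + A p) ≤ a / 100)) → ∃ j : Fin N, dist (x j) (x i) ≤ ρ ∧ c₁ ≤ (-(24 : ℝ) * (Literature.MathematicalPhysics.StatisticalMechanics.hcpPeriodicConfiguration ha.ne' hh.ne').energyPerParticle Literature.MathematicalPhysics.StatisticalMechanics.lennardJones) * Literature.MathematicalPhysics.StatisticalMechanics.siteEnergy (fun r => (r⁻¹) ^ 12) x j - (Literature.MathematicalPhysics.StatisticalMechanics.siteEnergy (fun r => (r⁻¹) ^ 6) x j) ^ 2 := by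
  sorry

/-- **STUB X — every cluster has a creditor** (size M; extreme points + uniform minimal distance).
For the optimal `(a, h)` some `c₃ > 0` gives in every Lennard-Jones ground state with `N ≥ 19` a site
with local deficit `C t_j − s_j² ≥ c₃` (an extreme point of the configuration: all neighbours in a
half-space, effective coordination `n_j = s_j²/t_j` well below `C ≈ 17.22`). -/
theorem stub_exposedCredit : ∀ (a h : ℝ) (ha : 0 < a) (hh : 0 < h), (∀ (a' h' : ℝ) (ha' : a' ≠ 0) (hh' : h' ≠ 0), (Literature.MathematicalPhysics.StatisticalMechanics.hcpPeriodicConfiguration ha.ne' hh.ne').energyPerParticle Literature.MathematicalPhysics.StatisticalMechanics.lennardJones ≤ (Literature.MathematicalPhysics.StatisticalMechanics.hcpPeriodicConfiguration ha' hh').energyPerParticle Literature.MathematicalPhysics.StatisticalMechanics.lennardJones) → ∃ c₃ : ℝ, 0 < c₃ ∧ ∀ (N : ℕ) (x : Fin N → EuclideanSpace ℝ (Fin 3)), Literature.MathematicalPhysics.StatisticalMechanics.IsGroundState Literature.MathematicalPhysics.StatisticalMechanics.lennardJones x → 19 ≤ N → ∃ j : Fin N, c₃ ≤ (-(24 : ℝ)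 * (Literature.MathematicalPhysics.StatisticalMechanics.hcpPeriodicConfiguration ha.ne' hh.ne').energyPerParticle Literature.MathematicalPhysics.StatisticalMechanics.lennardJones) * Literature.MathematicalPhysics.StatisticalMechanics.siteEnergy (fun r => (r⁻¹) ^ 12) x j - (Literature.MathematicalPhysics.StatisticalMechanics.siteEnergy (fun r => (r⁻¹) ^ 6) x j) ^ 2 := by
  sorry

/-! ## The composition (kernel-checked, no `sorry` outside the stubs) -/

/-- **`birth` for `PricingLarge` — the piece from the three stub STATEMENTS** (hypothesis form; the
conclusion is the piece's signature VERBATIM = registered `stub_pricingLarge`): packing count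
`K = (2ρ/δ + 1)³`, `c₀ := min (ε c₃ / (N₀ + 1)) (ε c₁ / K)`; mid-size clusters by the exposed creditor,
large clusters by creditor-counting and Markov. [folklore] -/
theorem PricingLarge_of_stubs : (∀ (a h : ℝ) (ha : 0 < a) (hh : 0 < h), (∀ (a' h' : ℝ) (ha' : a' ≠ 0) (hh' : h' ≠ 0), (Literature.MathematicalPhysics.StatisticalMechanics.hcpPeriodicConfiguration ha.ne' hh.ne').energyPerParticle Literature.MathematicalPhysics.StatisticalMechanics.lennardJones ≤ (Literature.MathematicalPhysics.StatisticalMechanics.hcpPeriodicConfiguration ha' hh').energyPerParticle Literature.MathematicalPhysics.StatisticalMechanics.lennardJones) → ∃ ε : ℝ, 0 < ε ∧ ∀ (N : ℕ) (x : Fin N → EuclideanSpace ℝ (Fin 3)), Literature.MathematicalPhysics.StatisticalMechanics.IsGroundState Literature.MathematicalPhysics.StatisticalMechanics.lennardJones x → 19 ≤ N → ε * ∑ j, max 0 ((-(24 : ℝ) * (Literature.MathematicalPhysics.StatisticalMechanics.hcpPeriodicConfiguration ha.ne' hh.ne').energyPerParticle Literature.MathematicalPhysics.StatisticalMechanics.lennardJones)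 * Literature.MathematicalPhysics.StatisticalMechanics.siteEnergy (fun r => (r⁻¹) ^ 12) x j - (Literature.MathematicalPhysics.StatisticalMechanics.siteEnergy (fun r => (r⁻¹) ^ 6) x j) ^ 2) ≤ (-(24 : ℝ) * (Literature.MathematicalPhysics.StatisticalMechanics.hcpPeriodicConfiguration ha.ne' hh.ne').energyPerParticle Literature.MathematicalPhysics.StatisticalMechanics.lennardJones) * ∑ i, Literature.MathematicalPhysics.StatisticalMechanics.siteEnergy (fun r => (r⁻¹) ^ 12) x i - ∑ i, (Literature.MathematicalPhysics.StatisticalMechanics.siteEnergy (fun r => (r⁻¹) ^ 6) x i) ^ 2) → (∀ (a h : ℝ) (ha : 0 < a) (hh : 0 < h), (∀ (a' h' : ℝ) (ha' : a' ≠ 0) (hh' : h' ≠ 0), (Literature.MathematicalPhysics.StatisticalMechanics.hcpPeriodicConfiguration ha.ne' hh.ne').energyPerParticle Literature.MathematicalPhysics.StatisticalMechanics.lennardJones ≤ (Literature.MathematicalPhysics.StatisticalMechanics.hcpPeriodicConfiguration ha' hh').energyPerParticle Literature.MathematicalPhysics.StatisticalMechanics.lennardJones) → ∃ N₀ : ℕ,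 ∃ ρ c₁ : ℝ, 0 < ρ ∧ 0 < c₁ ∧ ∀ (N : ℕ) (x : Fin N → EuclideanSpace ℝ (Fin 3)), Literature.MathematicalPhysics.StatisticalMechanics.IsGroundState Literature.MathematicalPhysics.StatisticalMechanics.lennardJones x → N₀ ≤ N → ∀ i : Fin N, ¬ (∃ A : EuclideanSpace ℝ (Fin 3) →ₗᵢ[ℝ] EuclideanSpace ℝ (Fin 3), (∀ p ∈ (Literature.MathematicalPhysics.StatisticalMechanics.hcpPeriodicConfiguration ha.ne' hh.ne').points, ‖p‖ ≤ 2 * a → ∃ k : Fin N, dist (x k) (x i + A p) ≤ a / 100) ∧ (∀ k : Fin N, dist (x k) (x i) ≤ 2 * a → ∃ p ∈ (Literature.MathematicalPhysics.StatisticalMechanics.hcpPeriodicConfiguration ha.ne' hh.ne').points, dist (x k) (x i + A p) ≤ a / 100)) → ∃ j : Fin N, dist (x j) (x i) ≤ ρ ∧ c₁ ≤ (-(24 : ℝ) * (Literature.MathematicalPhysics.StatisticalMechanics.hcpPeriodicConfiguration ha.ne' hh.ne').energyPerParticle Literature.MathematicalPhysics.StatisticalMechanics.lennardJones) * Literature.MathematicalPhysics.StatisticalMechanics.siteEnergy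 (fun r => (r⁻¹) ^ 12) x j - (Literature.MathematicalPhysics.StatisticalMechanics.siteEnergy (fun r => (r⁻¹) ^ 6) x j) ^ 2) → (∀ (a h : ℝ) (ha : 0 < a) (hh : 0 < h), (∀ (a' h' : ℝ) (ha' : a' ≠ 0) (hh' : h' ≠ 0), (Literature.MathematicalPhysics.StatisticalMechanics.hcpPeriodicConfiguration ha.ne' hh.ne').energyPerParticle Literature.MathematicalPhysics.StatisticalMechanics.lennardJones ≤ (Literature.MathematicalPhysics.StatisticalMechanics.hcpPeriodicConfiguration ha' hh').energyPerParticle Literature.MathematicalPhysics.StatisticalMechanics.lennardJones) → ∃ c₃ : ℝ, 0 < c₃ ∧ ∀ (N : ℕ) (x : Fin N → EuclideanSpace ℝ (Fin 3)), Literature.MathematicalPhysics.StatisticalMechanics.IsGroundState Literature.MathematicalPhysics.StatisticalMechanics.lennardJones x → 19 ≤ N → ∃ j : Fin N, c₃ ≤ (-(24 : ℝ) * (Literature.MathematicalPhysics.StatisticalMechanics.hcpPeriodicConfiguration ha.ne' hh.ne').energyPerParticle Literature.MathematicalPhysics.StatisticalMechanics.lennardJones) * Literature.MathematicalPhysics.StatisticalMechanics.siteEnergy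 (fun r => (r⁻¹) ^ 12) x j - (Literature.MathematicalPhysics.StatisticalMechanics.siteEnergy (fun r => (r⁻¹) ^ 6) x j) ^ 2) → (∀ (a h : ℝ) (ha : 0 < a) (hh : 0 < h), (∀ (a' h' : ℝ) (ha' : a' ≠ 0) (hh' : h' ≠ 0), (Literature.MathematicalPhysics.StatisticalMechanics.hcpPeriodicConfiguration ha.ne' hh.ne').energyPerParticle Literature.MathematicalPhysics.StatisticalMechanics.lennardJones ≤ (Literature.MathematicalPhysics.StatisticalMechanics.hcpPeriodicConfiguration ha' hh').energyPerParticle Literature.MathematicalPhysics.StatisticalMechanics.lennardJones) → ∃ c₀ : ℝ, 0 < c₀ ∧ ∀ (N : ℕ) (x : Fin N → EuclideanSpace ℝ (Fin 3)), Literature.MathematicalPhysics.StatisticalMechanics.IsGroundState Literature.MathematicalPhysics.StatisticalMechanics.lennardJones x → 19 ≤ N → c₀ * (Nat.card {i : Fin N // ¬ (∃ A : EuclideanSpace ℝ (Fin 3) →ₗᵢ[ℝ] EuclideanSpace ℝ (Fin 3), (∀ p ∈ (Literature.MathematicalPhysics.StatisticalMechanics.hcpPeriodicConfiguration ha.ne'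 hh.ne').points, ‖p‖ ≤ 2 * a → ∃ k : Fin N, dist (x k) (x i + A p) ≤ a / 100) ∧ (∀ k : Fin N, dist (x k) (x i) ≤ 2 * a → ∃ p ∈ (Literature.MathematicalPhysics.StatisticalMechanics.hcpPeriodicConfiguration ha.ne' hh.ne').points, dist (x k) (x i + A p) ≤ a / 100))} : ℝ) ≤ (-(24 : ℝ) * (Literature.MathematicalPhysics.StatisticalMechanics.hcpPeriodicConfiguration ha.ne' hh.ne').energyPerParticle Literature.MathematicalPhysics.StatisticalMechanics.lennardJones) * ∑ i, Literature.MathematicalPhysics.StatisticalMechanics.siteEnergy (fun r => (r⁻¹) ^ 12) x i - ∑ i, (Literature.MathematicalPhysics.StatisticalMechanics.siteEnergy (fun r => (r⁻¹) ^ 6) x i) ^ 2) := by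
  intro hT hL hX a h ha hh hopt
  obtain ⟨ε, hε, hcoll⟩ := hT a h ha hh hopt
  obtain ⟨N₀, ρ, c₁, hρ, hc₁, hloc⟩ := hL a h ha hh hopt
  obtain ⟨c₃, hc₃, hexp⟩ := hX a h ha hh hopt
  obtain ⟨δ, hδ, hsep⟩ := Literature.MathematicalPhysics.StatisticalMechanics.LennardJonesMinimalDistance_holds
  have hKpos : (0 : ℝ) < (2 * ρ / δ + 1) ^ 3 := by positivity
  have hN₀pos : (0 : ℝ) < (N₀ : ℝ) + 1 := by positivity
  refine ⟨min (ε * c₃ / ((N₀ : ℝ) + 1)) (ε * c₁ / (2 * ρ / δ + 1) ^ 3),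
    lt_min (by positivity) (div_pos (mul_pos hε hc₁) hKpos), ?_⟩
  intro N x hx hN
  classical
  -- the coarse defect predicate and the local deficit
  set Bad : Fin N → Prop := fun i => ¬ (∃ A : EuclideanSpace ℝ (Fin 3) →ₗᵢ[ℝ] EuclideanSpace ℝ (Fin 3), (∀ p ∈ (Literature.MathematicalPhysics.StatisticalMechanics.hcpPeriodicConfiguration ha.ne' hh.ne').points, ‖p‖ ≤ 2 * a → ∃ k : Fin N, dist (x k) (x i + A p) ≤ a / 100) ∧ (∀ k : Fin N, dist (x k) (x i) ≤ 2 * a → ∃ p ∈ (Literature.MathematicalPhysics.StatisticalMechanics.hcpPeriodicConfiguration ha.ne' hh.ne').points, dist (x k) (x i + A p) ≤ a / 100)) with hBad_def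
  have hcard0 : (0 : ℝ) ≤ (Nat.card {i : Fin N // Bad i} : ℝ) := Nat.cast_nonneg _
  have hcardN : (Nat.card {i : Fin N // Bad i} : ℝ) ≤ N := by
    rw [Nat.card_eq_fintype_card]
    exact_mod_cast (Fintype.card_subtype_le _).trans_eq (Fintype.card_fin N)
  -- local deficits: nonnegative parts dominate, and the collateral stub bounds their sum by `D / ε`
  have hterm_nonneg : ∀ j : Fin N, (0 : ℝ) ≤ max 0 ((-(24 : ℝ) * (Literature.MathematicalPhysics.StatisticalMechanics.hcpPeriodicConfiguration ha.ne' hh.ne').energyPerParticle Literature.MathematicalPhysics.StatisticalMechanics.lennardJones) * Literature.MathematicalPhysics.StatisticalMechanics.siteEnergy (fun r => (r⁻¹) ^ 12) x j - (Literature.MathematicalPhysics.StatisticalMechanics.siteEnergy (fun r => (r⁻¹) ^ 6) x j) ^ 2) := fun j => le_max_left _ _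
  have hD := hcoll N x hx hN
  by_cases hsmall : N ≤ N₀
  · -- mid-size clusters: one exposed creditor pays for everything (`#Bad ≤ N ≤ N₀`)
    obtain ⟨j₀, hj₀⟩ := hexp N x hx hN
    have h1 : ε * c₃ ≤ (-(24 : ℝ) * (Literature.MathematicalPhysics.StatisticalMechanics.hcpPeriodicConfiguration ha.ne' hh.ne').energyPerParticle Literature.MathematicalPhysics.StatisticalMechanics.lennardJones) * ∑ i, Literature.MathematicalPhysics.StatisticalMechanics.siteEnergy (fun r => (r⁻¹) ^ 12) x i - ∑ i, (Literature.MathematicalPhysics.StatisticalMechanics.siteEnergy (fun r => (r⁻¹) ^ 6) x i) ^ 2 := by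
      have h2 : c₃ ≤ ∑ j, max 0 ((-(24 : ℝ) * (Literature.MathematicalPhysics.StatisticalMechanics.hcpPeriodicConfiguration ha.ne' hh.ne').energyPerParticle Literature.MathematicalPhysics.StatisticalMechanics.lennardJones) * Literature.MathematicalPhysics.StatisticalMechanics.siteEnergy (fun r => (r⁻¹) ^ 12) x j - (Literature.MathematicalPhysics.StatisticalMechanics.siteEnergy (fun r => (r⁻¹) ^ 6) x j) ^ 2) :=
        calc c₃ ≤ max 0 ((-(24 : ℝ) * (Literature.MathematicalPhysics.StatisticalMechanics.hcpPeriodicConfiguration ha.ne' hh.ne').energyPerParticle Literature.MathematicalPhysics.StatisticalMechanics.lennardJones) * Literature.MathematicalPhysics.StatisticalMechanics.siteEnergy (fun r => (r⁻¹) ^ 12) x j₀ - (Literature.MathematicalPhysics.StatisticalMechanics.siteEnergy (fun r => (r⁻¹) ^ 6) x j₀) ^ 2) := hj₀.trans (le_max_right _ _)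
          _ ≤ ∑ j, max 0 ((-(24 : ℝ) * (Literature.MathematicalPhysics.StatisticalMechanics.hcpPeriodicConfiguration ha.ne' hh.ne').energyPerParticle Literature.MathematicalPhysics.StatisticalMechanics.lennardJones) * Literature.MathematicalPhysics.StatisticalMechanics.siteEnergy (fun r => (r⁻¹) ^ 12) x j - (Literature.MathematicalPhysics.StatisticalMechanics.siteEnergy (fun r => (r⁻¹) ^ 6) x j) ^ 2) :=
            Finset.single_le_sum (fun j _ => hterm_nonneg j) (Finset.mem_univ j₀)
      calc ε * c₃ ≤ ε * ∑ j, max 0 ((-(24 : ℝ) * (Literature.MathematicalPhysics.StatisticalMechanics.hcpPeriodicConfiguration ha.ne' hh.ne').energyPerParticle Literature.MathematicalPhysics.StatisticalMechanics.lennardJones) * Literature.MathematicalPhysics.StatisticalMechanics.siteEnergy (fun r => (r⁻¹) ^ 12) x j - (Literature.MathematicalPhysics.StatisticalMechanics.siteEnergy (fun r => (r⁻¹) ^ 6) x j) ^ 2) := mul_le_mul_of_nonneg_left h2 hε.le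
        _ ≤ _ := hD
    have hNle : (N : ℝ) ≤ (N₀ : ℝ) + 1 := by
      have : (N : ℝ) ≤ (N₀ : ℝ) := by exact_mod_cast hsmall
      linarith
    calc min (ε * c₃ / ((N₀ : ℝ) + 1)) (ε * c₁ / (2 * ρ / δ + 1) ^ 3) * (Nat.card {i : Fin N // Bad i} : ℝ)
        ≤ (ε * c₃ / ((N₀ : ℝ) + 1)) * ((N₀ : ℝ) + 1) :=
          mul_le_mul (min_le_left _ _) (hcardN.trans hNle) hcard0 (by positivity)
      _ = ε * c₃ := by field_simp
      _ ≤ _ := h1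
  · -- large clusters: every coarse defect has a creditor within `ρ`; creditors are Markov-counted
    have hN₀ : N₀ ≤ N := by omega
    have hnear : ∀ i, Bad i → ∃ j, dist (x j) (x i) ≤ ρ ∧ c₁ ≤ (-(24 : ℝ) * (Literature.MathematicalPhysics.StatisticalMechanics.hcpPeriodicConfiguration ha.ne' hh.ne').energyPerParticle Literature.MathematicalPhysics.StatisticalMechanics.lennardJones) * Literature.MathematicalPhysics.StatisticalMechanics.siteEnergy (fun r => (r⁻¹) ^ 12) x j - (Literature.MathematicalPhysics.StatisticalMechanics.siteEnergy (fun r => (r⁻¹) ^ 6) x j) ^ 2 :=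
      fun i hi => hloc N x hx hN₀ i hi
    -- (1) packing: at most `K` particles within `ρ` of any particle
    have hpack : ∀ j : Fin N,
        ((Finset.univ.filter fun i : Fin N => dist (x j) (x i) ≤ ρ).card : ℝ) ≤ (2 * ρ / δ + 1) ^ 3 := by
      intro j
      set S := Finset.univ.filter fun i : Fin N => dist (x j) (x i) ≤ ρ with hS
      have hcard : (S.image x).card = S.card := Finset.card_image_of_injective S hx.1
      have h1 : ∀ c ∈ S.image x, dist c (x j) ≤ ρ := by
        intro c hc
        obtain ⟨i, hi, rfl⟩ := Finset.mem_image.1 hc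
        rw [dist_comm]
        exact (Finset.mem_filter.1 hi).2
      have h2 : ∀ c ∈ S.image x, ∀ d ∈ S.image x, c ≠ d → δ ≤ dist c d := by
        intro c hc d hd hcd
        obtain ⟨i, -, rfl⟩ := Finset.mem_image.1 hc
        obtain ⟨i', -, rfl⟩ := Finset.mem_image.1 hd
        exact hsep N x hx i i' fun h => hcd (congrArg x h)
      have h3 := Literature.MathematicalPhysics.StatisticalMechanics.card_le_of_separated_of_dist_le (S.image x) (x j) hδ hρ.le h1 h2
      rw [finrank_euclideanSpace_fin, hcard] at h3
      exact h3
    -- (2) counting: `#Bad ≤ K · #Creditors`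
    set Cred : Finset (Fin N) := Finset.univ.filter fun j : Fin N => c₁ ≤ (-(24 : ℝ) * (Literature.MathematicalPhysics.StatisticalMechanics.hcpPeriodicConfiguration ha.ne' hh.ne').energyPerParticle Literature.MathematicalPhysics.StatisticalMechanics.lennardJones) * Literature.MathematicalPhysics.StatisticalMechanics.siteEnergy (fun r => (r⁻¹) ^ 12) x j - (Literature.MathematicalPhysics.StatisticalMechanics.siteEnergy (fun r => (r⁻¹) ^ 6) x j) ^ 2 with hCred
    have hcount : (Nat.card {i : Fin N // Bad i} : ℝ) ≤ (2 * ρ / δ + 1) ^ 3 * (Cred.card : ℝ) := by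
      have eB : Nat.card {i : Fin N // Bad i} = (Finset.univ.filter Bad).card := by
        rw [Nat.card_eq_fintype_card, Fintype.card_subtype]
      have hsub : Finset.univ.filter Bad ⊆
          Cred.biUnion fun j => Finset.univ.filter fun i : Fin N => dist (x j) (x i) ≤ ρ := by
        intro i hi
        obtain ⟨j, hj, hjc⟩ := hnear i (Finset.mem_filter.1 hi).2
        exact Finset.mem_biUnion.2 ⟨j, Finset.mem_filter.2 ⟨Finset.mem_univ _, hjc⟩,
          Finset.mem_filter.2 ⟨Finset.mem_univ _, hj⟩⟩
      have hle := (Finset.card_le_card hsub).trans Finset.card_biUnion_le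
      rw [eB]
      calc ((Finset.univ.filter Bad).card : ℝ)
          ≤ ((∑ j ∈ Cred, (Finset.univ.filter fun i : Fin N => dist (x j) (x i) ≤ ρ).card : ℕ) : ℝ) := by
            exact_mod_cast hle
        _ = ∑ j ∈ Cred, ((Finset.univ.filter fun i : Fin N => dist (x j) (x i) ≤ ρ).card : ℝ) := by
            push_cast
            rfl
        _ ≤ ∑ _j ∈ Cred, (2 * ρ / δ + 1) ^ 3 := Finset.sum_le_sum fun j _ => hpack j
        _ = (2 * ρ / δ + 1) ^ 3 * (Cred.card : ℝ) := by
            rw [Finset.sum_const, nsmul_eq_mul, mul_comm]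
    -- (3) Markov: `c₁ · #Creditors ≤ Σ_j (d_j)⁺ ≤ D / ε`
    have hmarkov : c₁ * (Cred.card : ℝ) ≤ ∑ j, max 0 ((-(24 : ℝ) * (Literature.MathematicalPhysics.StatisticalMechanics.hcpPeriodicConfiguration ha.ne' hh.ne').energyPerParticle Literature.MathematicalPhysics.StatisticalMechanics.lennardJones) * Literature.MathematicalPhysics.StatisticalMechanics.siteEnergy (fun r => (r⁻¹) ^ 12) x j - (Literature.MathematicalPhysics.StatisticalMechanics.siteEnergy (fun r => (r⁻¹) ^ 6) x j) ^ 2) :=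
      calc c₁ * (Cred.card : ℝ) = ∑ _j ∈ Cred, c₁ := by
            rw [Finset.sum_const, nsmul_eq_mul, mul_comm]
        _ ≤ ∑ j ∈ Cred, max 0 ((-(24 : ℝ) * (Literature.MathematicalPhysics.StatisticalMechanics.hcpPeriodicConfiguration ha.ne' hh.ne').energyPerParticle Literature.MathematicalPhysics.StatisticalMechanics.lennardJones) * Literature.MathematicalPhysics.StatisticalMechanics.siteEnergy (fun r => (r⁻¹) ^ 12) x j - (Literature.MathematicalPhysics.StatisticalMechanics.siteEnergy (fun r => (r⁻¹) ^ 6) x j) ^ 2) :=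
            Finset.sum_le_sum fun j hj => ((Finset.mem_filter.1 hj).2).trans (le_max_right _ _)
        _ ≤ ∑ j, max 0 ((-(24 : ℝ) * (Literature.MathematicalPhysics.StatisticalMechanics.hcpPeriodicConfiguration ha.ne' hh.ne').energyPerParticle Literature.MathematicalPhysics.StatisticalMechanics.lennardJones) * Literature.MathematicalPhysics.StatisticalMechanics.siteEnergy (fun r => (r⁻¹) ^ 12) x j - (Literature.MathematicalPhysics.StatisticalMechanics.siteEnergy (fun r => (r⁻¹) ^ 6) x j) ^ 2) :=
            Finset.sum_le_sum_of_subset_of_nonneg (Finset.subset_univ _) fun j _ _ => hterm_nonneg j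
    -- (4) the estimate
    calc min (ε * c₃ / ((N₀ : ℝ) + 1)) (ε * c₁ / (2 * ρ / δ + 1) ^ 3) * (Nat.card {i : Fin N // Bad i} : ℝ)
        ≤ (ε * c₁ / (2 * ρ / δ + 1) ^ 3) * ((2 * ρ / δ + 1) ^ 3 * (Cred.card : ℝ)) :=
          mul_le_mul (min_le_right _ _) hcount hcard0 (by positivity)
      _ = ε * (c₁ * (Cred.card : ℝ)) := by
          field_simp
      _ ≤ ε * ∑ j, max 0 ((-(24 : ℝ) * (Literature.MathematicalPhysics.StatisticalMechanics.hcpPeriodicConfiguration ha.ne' hh.ne').energyPerParticle Literature.MathematicalPhysics.StatisticalMechanics.lennardJones) * Literature.MathematicalPhysics.StatisticalMechanics.siteEnergy (fun r => (r⁻¹) ^ 12) x j - (Literature.MathematicalPhysics.StatisticalMechanics.siteEnergy (fun r => (r⁻¹) ^ 6) x j) ^ 2) := mul_le_mul_of_nonneg_left hmarkov hε.le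
      _ ≤ _ := hD

/-- The piece's statement from the registered stubs (the only `sorry`s in its cone are
`stub_collateral`, `stub_localCredit`, `stub_exposedCredit`).  Once the split is filed this is re-typed
BY NAME as `PricingLarge_of : …Theses.PRVarianceCertificate.PricingLarge` (definitional unfolding). -/
theorem PricingLarge_of_stubs' : ∀ (a h : ℝ) (ha : 0 < a) (hh : 0 < h), (∀ (a' h' : ℝ) (ha' : a' ≠ 0) (hh' : h' ≠ 0), (Literature.MathematicalPhysics.StatisticalMechanics.hcpPeriodicConfiguration ha.ne' hh.ne').energyPerParticle Literature.MathematicalPhysics.StatisticalMechanics.lennardJones ≤ (Literature.MathematicalPhysics.StatisticalMechanics.hcpPeriodicConfiguration ha' hh').energyPerParticle Literature.MathematicalPhysics.StatisticalMechanics.lennardJones) → ∃ c₀ : ℝ, 0 < c₀ ∧ ∀ (N : ℕ) (x : Fin N → EuclideanSpace ℝ (Fin 3)), Literature.MathematicalPhysics.StatisticalMechanics.IsGroundState Literature.MathematicalPhysics.StatisticalMechanics.lennardJones x → 19 ≤ N → c₀ * (Nat.card {i : Fin N // ¬ (∃ A : EuclideanSpace ℝ (Fin 3) →ₗᵢ[ℝ]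 EuclideanSpace ℝ (Fin 3), (∀ p ∈ (Literature.MathematicalPhysics.StatisticalMechanics.hcpPeriodicConfiguration ha.ne' hh.ne').points, ‖p‖ ≤ 2 * a → ∃ k : Fin N, dist (x k) (x i + A p) ≤ a / 100) ∧ (∀ k : Fin N, dist (x k) (x i) ≤ 2 * a → ∃ p ∈ (Literature.MathematicalPhysics.StatisticalMechanics.hcpPeriodicConfiguration ha.ne' hh.ne').points, dist (x k) (x i + A p) ≤ a / 100))} : ℝ) ≤ (-(24 : ℝ) * (Literature.MathematicalPhysics.StatisticalMechanics.hcpPeriodicConfiguration ha.ne' hh.ne').energyPerParticle Literature.MathematicalPhysics.StatisticalMechanics.lennardJones) * ∑ i, Literature.MathematicalPhysics.StatisticalMechanics.siteEnergy (fun r => (r⁻¹) ^ 12) x i - ∑ i, (Literature.MathematicalPhysics.StatisticalMechanics.siteEnergy (fun r => (r⁻¹) ^ 6) x i) ^ 2 :=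
  PricingLarge_of_stubs stub_collateral stub_localCredit stub_exposedCredit

end Summit.AtomisticToContinuum.Crystallization.Cruxes.PricingLarge.Birth

end
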